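import Literature.Computability.AlgebraicComplexity.CNFPermanent
import Literature.Computability.Complexity.CountingReductions
import Literature.LinearAlgebra.Matrix.PermanentTwoSiteGlueAll
import HarnessLib

/-!
# `#3SAT` as ONE integer permanent: the two-site arithmetisation of a 3CNF (Valiant 1979, Lemma 3.1)

Valiant, *The complexity of computing the permanent*, TCS 8 (1979), Lemma 3.1: "there is an
`f ∈ FP` from CNF formulae to matrices with entries from `{-1, 0, 1, 2, 3}` such that
`Perm f(F) = 4^{t(F)} · s(F)`", `s(F)` the number of satisfying assignments. This file constructs
such a matrix EXPLICITLY (every entry a closed-form function of the formula, so that the reduction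
machine of `Computability/QuantumComplexity/PermanentHardness.lean` can write it down) for a 3CNF
`φ` with `m` clauses, with entries in `{-1, 0, 1}` and the factor `2^{6m}`:

* `per (twoSiteMatrix φ) = 2^{6m} · #SAT(φ)` (`permanent_twoSiteMatrix`; `#SAT = CNF.numSat`).

The construction differs from Valiant's (and from Bürgisser–Clausen–Shokrollahi, Thm. (21.29),
proved in `PermanentBooleanSum.lean` with Valiant's `4 × 4` junctions, control entries and
`yCol`-enumerations, whose all-at-once matrix has no convenient closed form) in the coupling step:
every Boolean variable of the arithmetisation is given EXACTLY TWO sites, so that the division-free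
two-site gadget `permanent_glueAll` (`LinearAlgebra/Matrix/PermanentTwoSiteGlueAll.lean`) applies:

1. (`linCNF`) each literal POSITION `p = 3c + l` gets its own variable `Y_p`; the clause-product
   matrix of this linearised CNF (`CNFPermanent.lean`: `cnfMatrix`, a `7m × 7m` Hessenberg matrix
   with `per (Y := e) = [e ⊨ linCNF φ]`, the variables sitting alone on the diagonal at
   `sPos p = 7c + 2l + 1`, `cnfMatrix_linCNF_eq_inr_iff`) is the first block, its constants in
   closed form (`cnfW_eq_of_width3`, `clauseW_three_apply`, `w3c`, `hConst`);
2. consistency of the copies of a variable of `φ` is restored by one **equality block**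
   `E(U_{prev p}, Y_p, U_p) = (a,-1,-1,1; 0,b,-1,1; 0,0,c,1; 1,1,1,0)` per position (`e3`,
   `permanent_e3 : per = 1 - a - b - c + ab + ac + bc = [a = b = c]` on Booleans), chained along
   the cyclic order of the occurrences of each variable (`prevPos`/`nextPos`, the downward/upward
   scans, mutually inverse: `nextPos_prevPos`, `nextPos_eq_iff`); so `Y_p` has the two sites
   `sPos p` and slot `1` of block `p`, and the chain variable `U_p` the two sites slot `2` of
   block `p` and slot `0` of block `nextPos p` (`siteY`, `siteU`, all on the diagonal);
3. at a Boolean point the matrix is the block sum of the clause block and the equality blocks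
   (`sitePoint_baseMatrix`, `permanent_blockSum`), with permanent
   `[Y ⊨ linCNF φ] · ∏_p [U_{prev p} = Y_p = U_p]` (`permanent_sitePoint_baseMatrix`); summing out
   `U` leaves `[Y invariant under prevPos]` (`sum_prod_consistency`), i.e. `Y` constant on the
   occurrences of each variable (`eq_of_prevPos_invariant`), and these `Y` correspond to the
   assignments of `φ.vars` (`toY`/`toσ`, `eval_linCNF_comp_varAt`), whence
   `∑_b per A(b) = numSat φ` (`sum_permanent_sitePoint`) and the displayed formula by
   `permanent_glueAll`;
4. entries stay in `{-1, 0, 1}` (`twoSiteMatrix_apply_mem`) and `0 ≤ per ≤ 2^{9m}`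
   (`permanent_twoSiteMatrix_bounds`), which is what the `0/1` lift modulo `2^q + 1`
   (`PermanentZeroOneLift.lean`) needs downstream.

All definitions are `ℕ`-arithmetic on positions (`litAt`, `varAt`, `sPos`, `hConst`, `prevPos`,
`nextPos`) so that the polynomial-time machine can be proved to compute the same matrix.

## References

* L. G. Valiant, *The complexity of computing the permanent*, Theoret. Comput. Sci. 8 (1979)
  189–201, Lemma 3.1 and its proof (pp. 193–196).
* P. Bürgisser, M. Clausen, M. A. Shokrollahi, *Algebraic Complexity Theory*, Springer 1997,
  Thm. (21.29) (the coupling step; here in division-free two-site form).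
* P. Bürgisser, *On defining integers and proving arithmetic circuit lower bounds*, Comput.
  Complexity 18 (2009), proof of Thm. 2.10 (two-site Boolean sums, factor `2` per variable).
-/

noncomputable section
noncomputable section

open Matrix Finset

namespace Literature.Computability.AlgebraicComplexity

open Literature.Computability.Complexity Literature.LinearAlgebra.Matrix CNFPer

universe u v

namespace ThreeCNFPer

variable (φ : CNF ℕ)

/-! ### Positions, literals, the linearised CNF -/

/-- The literal of `φ` at clause `c`, position `l` (junk `(0, false)` out of range). [folklore] -/
def litAt (c l : ℕ) : Literal ℕ := (φ.getD c []).getD l (0, false)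

/-- The variable at the literal position `p = 3c + l`. [folklore] -/
def varAt (p : ℕ) : ℕ := (litAt φ (p / 3) (p % 3)).1

/-- **The linearised CNF**: the 3CNF on the variables `Fin (3m)` in which the literal position
`p = 3c + l` (clause `c`, `l`-th literal) carries its OWN variable `Y_p`, with the polarity of the
literal of `φ` at that position (consistency of the copies of a variable of `φ` is restored by the
equality blocks below). [cite: Valiant1979, Lemma 3.1] -/
def linCNF : CNF (Fin (φ.length * 3)) :=
  List.ofFn fun c : Fin φ.length => List.ofFn fun l : Fin 3 => (finProdFinEquiv (c, l), (litAt φ c l).2)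

/-- `linCNF φ` has `m` clauses. [folklore] -/
@[simp] theorem length_linCNF : (linCNF φ).length = φ.length := by simp [linCNF]

/-- The clauses of `linCNF φ`. [folklore] -/
theorem getD_linCNF {c : ℕ} (hc : c < φ.length) :
    (linCNF φ).getD c [] = List.ofFn fun l : Fin 3 => (finProdFinEquiv (⟨c, hc⟩, l), (litAt φ c l).2) := by
  rw [linCNF, List.getD_eq_getElem _ _ (by simpa using hc), List.getElem_ofFn]

/-- Every clause of `linCNF φ` has exactly three literals. [folklore] -/
theorem length_of_mem_linCNF {cl : Clause (Fin (φ.length * 3))} (h : cl ∈ linCNF φ) : cl.length = 3 := by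
  simp only [linCNF, List.mem_ofFn] at h
  obtain ⟨c, rfl⟩ := h
  simp

/-- The dimension of the clause-product matrix of a CNF all of whose clauses have three literals
is `7m`. [cite: Valiant1979, Lemma 3.1] -/
theorem cnfDim_eq_of_width3 {ν : Type*} : ∀ (ψ : CNF ν), (∀ cl ∈ ψ, cl.length = 3) → cnfDim ψ = 7 * ψ.length
  | [], _ => rfl
  | cl :: cs, h => by
    rw [cnfDim_cons, h cl List.mem_cons_self, cnfDim_eq_of_width3 cs (fun c hc => h c (List.mem_cons_of_mem _ hc)),
      List.length_cons]
    ring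

/-- `cnfDim (linCNF φ) = 7m`. [cite: Valiant1979, Lemma 3.1] -/
theorem cnfDim_linCNF : cnfDim (linCNF φ) = 7 * φ.length := by
  rw [cnfDim_eq_of_width3 _ (fun cl h => length_of_mem_linCNF φ h), length_linCNF]

/-! ### The weights of the series DAG of a width-3 CNF in closed form -/

section Weights

variable {k : Type u} [CommRing k] {σ : Type v} {t : ℕ}

/-- **Block form of the CNF DAG**: for a CNF all of whose clauses have three literals, the edge
`a → b` (`b ≥ 1`) of the series composition belongs to the clause block `j = (b-1)/7` and is the
corresponding edge of that clause's DAG in local coordinates, provided `a` lies in the same block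
(`7j ≤ a`); all other weights vanish. [cite: Valiant1979, Lemma 3.1] -/
theorem cnfW_eq_of_width3 : ∀ (ψ : CNF (Fin t)), (∀ cl ∈ ψ, cl.length = 3) → ∀ (a b : ℕ), 1 ≤ b →
    cnfW (k := k) (σ := σ) ψ a b =
      if (b - 1) / 7 < ψ.length ∧ 7 * ((b - 1) / 7) ≤ a then
        clauseW (ψ.getD ((b - 1) / 7) []) (a - 7 * ((b - 1) / 7)) (b - 7 * ((b - 1) / 7))
      else Sum.inl 0
  | [], _, a, b, _ => by simp [cnfW]
  | cl :: cs, h, a, b, hb => by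
    have hcl : cl.length = 3 := h cl List.mem_cons_self
    have hcs : ∀ c ∈ cs, c.length = 3 := fun c hc => h c (List.mem_cons_of_mem _ hc)
    rw [cnfW, hcl, show 2 * 3 + 1 = 7 by rfl, seriesW]
    by_cases hb7 : b ≤ 7
    · have hj : (b - 1) / 7 = 0 := by omega
      rw [if_pos hb7, hj]
      simp
    · rw [if_neg hb7]
      have hj : (b - 1) / 7 = (b - 7 - 1) / 7 + 1 := by omega
      by_cases ha : 7 ≤ a
      · rw [if_pos ha, cnfW_eq_of_width3 cs hcs (a - 7) (b - 7) (by omega), hj, List.length_cons,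
          List.getD_cons_succ]
        have e1 : a - 7 - 7 * ((b - 7 - 1) / 7) = a - 7 * ((b - 7 - 1) / 7 + 1) := by omega
        have e2 : b - 7 - 7 * ((b - 7 - 1) / 7) = b - 7 * ((b - 7 - 1) / 7 + 1) := by omega
        rw [e1, e2]
        congr 1
        exact propext ⟨fun ⟨h1, h2⟩ => ⟨by omega, by omega⟩, fun ⟨h1, h2⟩ => ⟨by omega, by omega⟩⟩
      · rw [if_neg ha, hj, if_neg]
        omega

/-- **The weights of a three-literal clause block, in full**: the clause edge `6 → 7` (`-1`) and
the bypass `0 → 7` (`1`), and for the literal `l` on the nodes `2l, 2l+1, 2l+2` the edges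
`2l → 2l+1` (`s`), `2l → 2l+2` (`p`), `2l+1 → 2l+2` (the variable). [cite: Valiant1979, Lemma 3.1] -/
theorem clauseW_three_apply (l₀ l₁ l₂ : Literal (Fin t)) (a b : ℕ) :
    clauseW (k := k) (σ := σ) [l₀, l₁, l₂] a b =
      if b = 7 then Sum.inl ((if a = 0 then 1 else 0) + (if a = 6 then -1 else 0))
      else if a = 0 ∧ b = 1 then Sum.inl (litS l₀) else if a = 0 ∧ b = 2 then Sum.inl (litP l₀)
      else if a = 1 ∧ b = 2 then Sum.inr (Sum.inr l₀.1)
      else if a = 2 ∧ b = 3 then Sum.inl (litS l₁) else if a = 2 ∧ b = 4 then Sum.inl (litP l₁)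
      else if a = 3 ∧ b = 4 then Sum.inr (Sum.inr l₁.1)
      else if a = 4 ∧ b = 5 then Sum.inl (litS l₂) else if a = 4 ∧ b = 6 then Sum.inl (litP l₂)
      else if a = 5 ∧ b = 6 then Sum.inr (Sum.inr l₂.1) else Sum.inl 0 := by
  unfold clauseW
  simp only [List.length_cons, List.length_nil]
  by_cases hb7 : b = 7
  · subst hb7; simp
  rw [if_neg hb7, if_neg hb7]
  simp only [litChainW, seriesW, litW]
  by_cases h1 : a = 0 ∧ b = 1
  · obtain ⟨rfl, rfl⟩ := h1; simp
  by_cases h2 : a = 0 ∧ b = 2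
  · obtain ⟨rfl, rfl⟩ := h2; simp
  by_cases h3 : a = 1 ∧ b = 2
  · obtain ⟨rfl, rfl⟩ := h3; simp
  by_cases h4 : a = 2 ∧ b = 3
  · obtain ⟨rfl, rfl⟩ := h4; simp
  by_cases h5 : a = 2 ∧ b = 4
  · obtain ⟨rfl, rfl⟩ := h5; simp
  by_cases h6 : a = 3 ∧ b = 4
  · obtain ⟨rfl, rfl⟩ := h6; simp
  by_cases h7 : a = 4 ∧ b = 5
  · obtain ⟨rfl, rfl⟩ := h7; simp
  by_cases h8 : a = 4 ∧ b = 6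
  · obtain ⟨rfl, rfl⟩ := h8; simp
  by_cases h9 : a = 5 ∧ b = 6
  · obtain ⟨rfl, rfl⟩ := h9; simp
  -- none of the nine edges: the weight is `0`
  simp only [h1, h2, h3, h4, h5, h6, h7, h8, h9, if_false]
  by_cases hb2 : b ≤ 2
  · rw [if_pos hb2]
  rw [if_neg hb2]
  by_cases ha2 : 2 ≤ a
  · rw [if_pos ha2]
    by_cases hb4 : b - 2 ≤ 2
    · rw [if_pos hb4, if_neg (by omega), if_neg (by omega), if_neg (by omega)]
    rw [if_neg hb4]
    by_cases ha4 : 2 ≤ a - 2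
    · rw [if_pos ha4]
      by_cases hb6 : b - 2 - 2 ≤ 2
      · rw [if_pos hb6, if_neg (by omega), if_neg (by omega), if_neg (by omega)]
      · rw [if_neg hb6]; split_ifs <;> rfl
    · rw [if_neg ha4]
  · rw [if_neg ha2]

/-- **Where the variables of a three-literal clause block sit**: the weight `a → b` is a variable
iff `(a, b) = (2l+1, 2l+2)` for some `l < 3`, and then it is the variable of `ℓ_l`. [cite: Valiant1979, Lemma 3.1] -/
theorem clauseW_three_eq_inr_iff (l₀ l₁ l₂ : Literal (Fin t)) (a b : ℕ) (y : σ ⊕ Fin t) :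
    clauseW (k := k) (σ := σ) [l₀, l₁, l₂] a b = Sum.inr y ↔
      (a = 1 ∧ b = 2 ∧ y = Sum.inr l₀.1) ∨ (a = 3 ∧ b = 4 ∧ y = Sum.inr l₁.1) ∨
        (a = 5 ∧ b = 6 ∧ y = Sum.inr l₂.1) := by
  rw [clauseW_three_apply]
  split_ifs with h1 h2 h3 h4 h5 h6 h7 h8 h9 h10
  · simp only [false_iff, not_or]
    exact ⟨fun h => by omega, fun h => by omega, fun h => by omega⟩
  · simp only [false_iff, not_or]
    exact ⟨fun h => by omega, fun h => by omega, fun h => by omega⟩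
  · simp only [false_iff, not_or]
    exact ⟨fun h => by omega, fun h => by omega, fun h => by omega⟩
  · simp only [Sum.inr.injEq, h4, true_and]
    exact ⟨fun h => Or.inl h.symm, fun h => by rcases h with h | h | h <;> [exact h.symm; omega; omega]⟩
  · simp only [false_iff, not_or]
    exact ⟨fun h => by omega, fun h => by omega, fun h => by omega⟩
  · simp only [false_iff, not_or]
    exact ⟨fun h => by omega, fun h => by omega, fun h => by omega⟩
  · simp only [Sum.inr.injEq, h7, true_and]
    exact ⟨fun h => Or.inr (Or.inl h.symm), fun h => by rcases h with h | h | h <;> [omega; exact h.symm; omega]⟩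
  · simp only [false_iff, not_or]
    exact ⟨fun h => by omega, fun h => by omega, fun h => by omega⟩
  · simp only [false_iff, not_or]
    exact ⟨fun h => by omega, fun h => by omega, fun h => by omega⟩
  · simp only [Sum.inr.injEq, h10, true_and]
    exact ⟨fun h => Or.inr (Or.inr h.symm), fun h => by rcases h with h | h | h <;> [omega; omega; exact h.symm]⟩
  · simp only [false_iff, not_or]
    exact ⟨fun h => by omega, fun h => by omega, fun h => by omega⟩

/-- The constant part of a weight (variables read as `0`). [folklore] -/
def constPart {τ : Type*} : k ⊕ τ → k := Sum.elim id fun _ => 0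

/-- `constPart` of a constant. [folklore] -/
@[simp] theorem constPart_inl {τ : Type*} (z : k) : constPart (Sum.inl z : k ⊕ τ) = z := rfl
/-- `constPart` of a variable. [folklore] -/
@[simp] theorem constPart_inr {τ : Type*} (y : τ) : constPart (Sum.inr y : k ⊕ τ) = 0 := rfl

/-- **The constant weights of a three-literal clause block in closed form** (local coordinates
`a → b`, polarities `pol 0, pol 1, pol 2`): the clause edge `6 → 7` of weight `-1` and the bypass
`0 → 7` of weight `1`; for the literal `l` on the nodes `2l, 2l+1, 2l+2` the edge `2l → 2l+1` of
weight `s = ∓1` and `2l → 2l+2` of weight `p = [positive]` (`1 - ℓ = p + s Y`); everything else,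
including the variable edges `2l+1 → 2l+2`, has constant part `0`. [cite: Valiant1979, Lemma 3.1] -/
def w3c (pol : ℕ → Bool) (a b : ℕ) : k :=
  if b = 7 then (if a = 0 then 1 else 0) + (if a = 6 then -1 else 0)
  else if b < 7 ∧ a + 1 = b ∧ b % 2 = 1 then (if pol (b / 2) then -1 else 1)
  else if b < 7 ∧ a + 2 = b ∧ b % 2 = 0 ∧ 0 < b then (if pol (b / 2 - 1) then 1 else 0)
  else 0

/-- **The constant weights of a three-literal clause block are `w3c`.** [cite: Valiant1979, Lemma 3.1] -/
theorem constPart_clauseW_three (l₀ l₁ l₂ : Literal (Fin t)) (a b : ℕ) :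
    constPart (clauseW (k := k) (σ := σ) [l₀, l₁, l₂] a b) =
      w3c (fun i => if i = 0 then l₀.2 else if i = 1 then l₁.2 else l₂.2) a b := by
  rw [clauseW_three_apply]
  unfold w3c litS litP
  by_cases hb7 : b = 7
  · subst hb7; simp
  rw [if_neg hb7, if_neg hb7]
  by_cases h1 : a = 0 ∧ b = 1
  · obtain ⟨rfl, rfl⟩ := h1; simp
  rw [if_neg h1]
  by_cases h2 : a = 0 ∧ b = 2
  · obtain ⟨rfl, rfl⟩ := h2; simp
  rw [if_neg h2]
  by_cases h3 : a = 1 ∧ b = 2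
  · obtain ⟨rfl, rfl⟩ := h3; simp
  rw [if_neg h3]
  by_cases h4 : a = 2 ∧ b = 3
  · obtain ⟨rfl, rfl⟩ := h4; simp
  rw [if_neg h4]
  by_cases h5 : a = 2 ∧ b = 4
  · obtain ⟨rfl, rfl⟩ := h5; simp
  rw [if_neg h5]
  by_cases h6 : a = 3 ∧ b = 4
  · obtain ⟨rfl, rfl⟩ := h6; simp
  rw [if_neg h6]
  by_cases h7 : a = 4 ∧ b = 5
  · obtain ⟨rfl, rfl⟩ := h7; simp
  rw [if_neg h7]
  by_cases h8 : a = 4 ∧ b = 6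
  · obtain ⟨rfl, rfl⟩ := h8; simp
  rw [if_neg h8]
  by_cases h9 : a = 5 ∧ b = 6
  · obtain ⟨rfl, rfl⟩ := h9; simp
  rw [if_neg h9, if_neg (by omega), if_neg (by omega), constPart_inl]

/-- The constant weights lie in `{-1, 0, 1}`. [cite: Valiant1979, Lemma 3.1] -/
theorem w3c_mem (pol : ℕ → Bool) (a b : ℕ) :
    w3c (k := k) pol a b = -1 ∨ w3c (k := k) pol a b = 0 ∨ w3c (k := k) pol a b = 1 := by
  unfold w3c
  by_cases hb7 : b = 7
  · rw [if_pos hb7]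
    by_cases ha0 : a = 0
    · rw [if_pos ha0, if_neg (by omega)]; simp
    · rw [if_neg ha0]
      by_cases ha6 : a = 6
      · rw [if_pos ha6]; simp
      · rw [if_neg ha6]; simp
  · rw [if_neg hb7]
    split_ifs <;> simp


/-- `w3c` only reads the polarities of the three literals. [folklore] -/
theorem w3c_congr {pol pol' : ℕ → Bool} (h : ∀ i < 3, pol i = pol' i) (a b : ℕ) :
    w3c (k := k) pol a b = w3c pol' a b := by
  unfold w3c
  by_cases h1 : b = 7
  · subst h1; rfl
  rw [if_neg h1, if_neg h1]
  by_cases h2 : b < 7 ∧ a + 1 = b ∧ b % 2 = 1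
  · rw [if_pos h2, if_pos h2, h (b / 2) (by omega)]
  rw [if_neg h2, if_neg h2]
  by_cases h3 : b < 7 ∧ a + 2 = b ∧ b % 2 = 0 ∧ 0 < b
  · rw [if_pos h3, if_pos h3, h (b / 2 - 1) (by omega)]
  rw [if_neg h3, if_neg h3]

end Weights

/-! ### The clause-product matrix of the linearised CNF: sites and constants -/

section LinMatrix

variable {k : Type u} [CommRing k] {σ : Type v}

/-- **The diagonal site of a literal position**: the variable `Y_p` of the position `p = 3c + l`
sits at the diagonal entry `7c + 2l + 1` of the clause-product matrix. [cite: Valiant1979, Lemma 3.1] -/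
def sPos (p : ℕ) : ℕ := 7 * (p / 3) + 2 * (p % 3) + 1

/-- Sites are inside the matrix. [folklore] -/
theorem sPos_lt {p n : ℕ} (hp : p < n * 3) : sPos p < 7 * n := by unfold sPos; omega

/-- Distinct positions have distinct sites. [folklore] -/
theorem sPos_injective : Function.Injective sPos := fun p q h => by unfold sPos at h; omega

/-- The clause block of a site. [folklore] -/
theorem sPos_div (p : ℕ) : sPos p / 7 = p / 3 := by unfold sPos; omega

/-- The clauses of `linCNF φ` as three-element lists. [folklore] -/
theorem getD_linCNF_three {c : ℕ} (hc : c < φ.length) :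
    (linCNF φ).getD c [] = [(finProdFinEquiv (⟨c, hc⟩, (0 : Fin 3)), (litAt φ c 0).2),
      (finProdFinEquiv (⟨c, hc⟩, (1 : Fin 3)), (litAt φ c 1).2),
      (finProdFinEquiv (⟨c, hc⟩, (2 : Fin 3)), (litAt φ c 2).2)] := by
  rw [getD_linCNF φ hc, List.ofFn_succ, List.ofFn_succ, List.ofFn_succ, List.ofFn_zero]
  rfl

/-- The value of `finProdFinEquiv (c, l)` is `l + 3c`. [folklore] -/
theorem val_finProdFinEquiv (c : Fin φ.length) (l : Fin 3) :
    (finProdFinEquiv (c, l) : Fin (φ.length * 3)).val = l.val + 3 * c.val := by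
  simp

/-- **The variables of the clause-product matrix of `linCNF φ` sit exactly at the diagonal sites**:
the entry `(r, c)` is a variable iff `r = c = sPos p` for a literal position `p`, and then it is
`Y_p`. [cite: Valiant1979, Lemma 3.1] -/
theorem cnfMatrix_linCNF_eq_inr_iff (r c : Fin (cnfDim (linCNF φ))) (y : σ ⊕ Fin (φ.length * 3)) :
    cnfMatrix (k := k) (σ := σ) (linCNF φ) r c = Sum.inr y ↔
      ∃ p : Fin (φ.length * 3), y = Sum.inr p ∧ r.val = sPos p.val ∧ c.val = sPos p.val := by
  rw [cnfMatrix, symHess_eq_inr_iff,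
    cnfW_eq_of_width3 _ (fun cl h => length_of_mem_linCNF φ h) _ _ (Nat.succ_pos _)]
  simp only [Nat.succ_sub_one, Nat.succ_eq_add_one, length_linCNF]
  constructor
  · rintro ⟨hrc, h⟩
    split_ifs at h with hcond
    · obtain ⟨hjm, hja⟩ := hcond
      rw [getD_linCNF_three φ hjm, clauseW_three_eq_inr_iff] at h
      rcases h with ⟨ha, hb, hy⟩ | ⟨ha, hb, hy⟩ | ⟨ha, hb, hy⟩
      · refine ⟨_, hy, ?_, ?_⟩ <;>
          (rw [val_finProdFinEquiv]; simp only [Fin.val_zero, sPos]; omega)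
      · refine ⟨_, hy, ?_, ?_⟩ <;>
          (rw [val_finProdFinEquiv]; simp only [Fin.val_one, sPos]; omega)
      · refine ⟨_, hy, ?_, ?_⟩ <;>
          (rw [val_finProdFinEquiv]; simp only [Fin.val_two, sPos]; omega)
  · rintro ⟨p, rfl, hr, hc⟩
    have hp := p.isLt
    simp only [sPos] at hr hc
    have hjm : c.val / 7 < φ.length := by omega
    refine ⟨Fin.le_def.2 (by omega), ?_⟩
    rw [if_pos ⟨hjm, by omega⟩, getD_linCNF_three φ hjm, clauseW_three_eq_inr_iff]
    have key : ∀ l : Fin 3, p.val % 3 = l.val →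
        Sum.inr p = (Sum.inr (finProdFinEquiv (⟨c.val / 7, hjm⟩, l)) : σ ⊕ Fin (φ.length * 3)) := by
      intro l hl
      congr 1
      apply Fin.ext
      rw [val_finProdFinEquiv]
      dsimp only
      omega
    have h3 : p.val % 3 = 0 ∨ p.val % 3 = 1 ∨ p.val % 3 = 2 := by omega
    rcases h3 with h0 | h1 | h2
    · exact Or.inl ⟨by omega, by omega, key 0 h0⟩
    · exact Or.inr (Or.inl ⟨by omega, by omega, key 1 h1⟩)
    · exact Or.inr (Or.inr ⟨by omega, by omega, key 2 h2⟩)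

/-- **The constant entries of the clause-product matrix of `linCNF φ`, `ℕ`-indexed** (variables
read as `0`, `0` off range): the subdiagonal `1`s, and inside the clause block `j = c/7` the
closed-form weights `w3c` of the edge `r → c+1` in local coordinates. [cite: Valiant1979, Lemma 3.1] -/
def hConst (r c : ℕ) : ℤ :=
  if r = c + 1 then 1
  else if r ≤ c then
    (if c / 7 < φ.length ∧ 7 * (c / 7) ≤ r then
      w3c (fun i => (litAt φ (c / 7) i).2) (r - 7 * (c / 7)) (c + 1 - 7 * (c / 7)) else 0)
  else 0

/-- The constant part of the clause-product matrix of `linCNF φ` is `hConst φ`. [cite: Valiant1979, Lemma 3.1] -/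
theorem constPart_cnfMatrix_linCNF (r c : Fin (cnfDim (linCNF φ))) :
    constPart (cnfMatrix (k := ℤ) (σ := σ) (linCNF φ) r c) = hConst φ r.val c.val := by
  unfold cnfMatrix symHess hConst
  by_cases h1 : r.val = c.val + 1
  · rw [if_pos h1, if_pos h1]; rfl
  rw [if_neg h1, if_neg h1]
  by_cases h2 : r.val ≤ c.val
  · rw [if_pos h2, if_pos h2, cnfW_eq_of_width3 _ (fun cl h => length_of_mem_linCNF φ h) _ _ (Nat.succ_pos _)]
    simp only [Nat.succ_sub_one, Nat.succ_eq_add_one, length_linCNF]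
    split_ifs with hcond
    · rw [getD_linCNF_three φ hcond.1, constPart_clauseW_three]
      exact w3c_congr (fun i hi => by
        rcases Nat.lt_or_ge i 1 with h0 | h0
        · simp [show i = 0 by omega]
        · rcases Nat.lt_or_ge i 2 with h1' | h1'
          · simp [show i = 1 by omega]
          · simp [show i = 2 by omega]) _ _
    · rfl
  · rw [if_neg h2, if_neg h2]; rfl

/-- The constant entries lie in `{-1, 0, 1}`. [cite: Valiant1979, Lemma 3.1] -/
theorem hConst_mem (r c : ℕ) : hConst φ r c = -1 ∨ hConst φ r c = 0 ∨ hConst φ r c = 1 := by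
  unfold hConst
  split_ifs
  · simp
  · exact w3c_mem _ _ _
  · simp
  · simp

end LinMatrix

/-! ### The cyclic order of the occurrences of a variable: `prevPos`, `nextPos` -/

section Scans

variable (N : ℕ) (v : ℕ → ℕ)

/-- **The previous occurrence**, cyclically: the largest position `q < p` with the same variable
as `p`, and if there is none, the largest position `q < N` with that variable (the last occurrence;
`p` itself if `p` is the only one). Written with `Nat.findGreatest`, i.e. as the downward scan the
reduction machine performs. [cite: Valiant1979, Lemma 3.1] -/
def prevPos (p : ℕ) : ℕ := by
  classical
  exact if ∃ q, q < p ∧ v q = v p then Nat.findGreatest (fun q => v q = v p) (p - 1)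
    else Nat.findGreatest (fun q => v q = v p) (N - 1)

/-- **The next occurrence**, cyclically: the least position `q` with `p < q < N` and the same
variable, and if there is none, the least position `q < N` with that variable (the first
occurrence). Written with `Nat.find`, i.e. as the upward scan the machine performs. [cite: Valiant1979, Lemma 3.1] -/
def nextPos (p : ℕ) : ℕ := by
  classical
  exact if h : ∃ q, p < q ∧ q < N ∧ v q = v p then Nat.find h
    else if h' : ∃ q, q < N ∧ v q = v p then Nat.find h' else 0

variable {N v}

/-- The previous occurrence when an earlier occurrence exists: it is `< p`, has the same variable,
and no occurrence lies strictly between. [folklore] -/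
theorem prevPos_of_exists {p : ℕ} (h : ∃ q, q < p ∧ v q = v p) :
    prevPos N v p < p ∧ v (prevPos N v p) = v p ∧
      ∀ q, prevPos N v p < q → q < p → v q ≠ v p := by
  classical
  unfold prevPos
  rw [if_pos h]
  obtain ⟨q, hq, hvq⟩ := h
  refine ⟨(Nat.findGreatest_le _).trans_lt (by omega),
    Nat.findGreatest_spec (P := fun q => v q = v p) (m := q) (by omega) hvq, fun q' h1 h2 => ?_⟩
  exact Nat.findGreatest_is_greatest (P := fun q => v q = v p) h1 (by omega)

/-- The previous occurrence when NO earlier occurrence exists (`p < N`): it is the last occurrence,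
`p ≤ prevPos < N`, same variable, nothing after it. [folklore] -/
theorem prevPos_of_not_exists {p : ℕ} (hp : p < N) (h : ¬ ∃ q, q < p ∧ v q = v p) :
    p ≤ prevPos N v p ∧ prevPos N v p < N ∧ v (prevPos N v p) = v p ∧
      ∀ q, prevPos N v p < q → q < N → v q ≠ v p := by
  classical
  unfold prevPos
  rw [if_neg h]
  refine ⟨Nat.le_findGreatest (P := fun q => v q = v p) (by omega) rfl,
    (Nat.findGreatest_le _).trans_lt (by omega),
    Nat.findGreatest_spec (P := fun q => v q = v p) (m := p) (by omega) rfl, fun q' h1 h2 => ?_⟩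
  exact Nat.findGreatest_is_greatest (P := fun q => v q = v p) h1 (by omega)

/-- `prevPos p < N` and it has the same variable (`p < N`). [folklore] -/
theorem prevPos_lt {p : ℕ} (hp : p < N) : prevPos N v p < N ∧ v (prevPos N v p) = v p := by
  by_cases h : ∃ q, q < p ∧ v q = v p
  · have := prevPos_of_exists (N := N) h
    exact ⟨this.1.trans hp, this.2.1⟩
  · have := prevPos_of_not_exists hp h
    exact ⟨this.2.1, this.2.2.1⟩

/-- An earlier occurrence is at most the previous one: `q < p`, same variable ⟹ `q ≤ prevPos p < p`. [folklore] -/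
theorem le_prevPos_of_lt {p q : ℕ} (hq : q < p) (hv : v q = v p) :
    q ≤ prevPos N v p ∧ prevPos N v p < p := by
  classical
  have h : ∃ q, q < p ∧ v q = v p := ⟨q, hq, hv⟩
  refine ⟨?_, (prevPos_of_exists (N := N) h).1⟩
  unfold prevPos
  rw [if_pos h]
  exact Nat.le_findGreatest (P := fun q => v q = v p) (by omega) hv

/-- **`nextPos` inverts `prevPos`**: `nextPos (prevPos p) = p` for `p < N`. [folklore] -/
theorem nextPos_prevPos {p : ℕ} (hp : p < N) : nextPos N v (prevPos N v p) = p := by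
  classical
  by_cases h : ∃ q, q < p ∧ v q = v p
  · obtain ⟨hQp, hvQ, hgap⟩ := prevPos_of_exists (N := N) h
    have hex : ∃ q, prevPos N v p < q ∧ q < N ∧ v q = v (prevPos N v p) := ⟨p, hQp, hp, hvQ.symm⟩
    unfold nextPos
    rw [dif_pos hex, Nat.find_eq_iff]
    refine ⟨⟨hQp, hp, hvQ.symm⟩, fun q hq ⟨h1, _, h3⟩ => hgap q h1 hq (h3.trans hvQ)⟩
  · obtain ⟨hpQ, hQN, hvQ, hgap⟩ := prevPos_of_not_exists hp h
    have hnex : ¬ ∃ q, prevPos N v p < q ∧ q < N ∧ v q = v (prevPos N v p) :=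
      fun ⟨q, h1, h2, h3⟩ => hgap q h1 h2 (h3.trans hvQ)
    have hex : ∃ q, q < N ∧ v q = v (prevPos N v p) := ⟨p, hp, hvQ.symm⟩
    unfold nextPos
    rw [dif_neg hnex, dif_pos hex, Nat.find_eq_iff]
    exact ⟨⟨hp, hvQ.symm⟩, fun q hq ⟨_, h3⟩ => h ⟨q, hq, h3.trans hvQ⟩⟩

/-- `prevPos` as a map of `Fin N`. [folklore] -/
def prevFin (p : Fin N) : Fin N := ⟨prevPos N v p, (prevPos_lt p.isLt).1⟩

/-- `prevFin` is a bijection of `Fin N` (it has the left inverse `nextPos`, and `Fin N` is finite). [folklore] -/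
theorem prevFin_bijective : Function.Bijective (prevFin (N := N) (v := v)) := by
  have hinj : Function.Injective (prevFin (N := N) (v := v)) := by
    intro p q h
    apply Fin.ext
    have h' : prevPos N v p = prevPos N v q := congrArg Fin.val h
    rw [← nextPos_prevPos (v := v) p.isLt, ← nextPos_prevPos (v := v) q.isLt, h']
  exact ⟨hinj, Finite.surjective_of_injective hinj⟩

/-- `nextPos p < N` for `p < N`, and it has the same variable. [folklore] -/
theorem nextPos_lt {p : ℕ} (hp : p < N) : nextPos N v p < N ∧ v (nextPos N v p) = v p := by
  obtain ⟨q, hq⟩ := (prevFin_bijective (N := N) (v := v)).2 ⟨p, hp⟩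
  have hq' : prevPos N v q = p := congrArg Fin.val hq
  rw [← hq', nextPos_prevPos q.isLt]
  exact ⟨q.isLt, (prevPos_lt (v := v) q.isLt).2.symm⟩

/-- **`nextPos q = p ↔ q = prevPos p`** on `[0, N)`. [folklore] -/
theorem nextPos_eq_iff {p q : ℕ} (hp : p < N) (hq : q < N) : nextPos N v q = p ↔ q = prevPos N v p := by
  constructor
  · intro h
    obtain ⟨q', hq'⟩ := (prevFin_bijective (N := N) (v := v)).2 ⟨q, hq⟩
    have e : prevPos N v q' = q := congrArg Fin.val hq'
    rw [← e, nextPos_prevPos q'.isLt] at h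
    rw [← e, h]
  · rintro rfl
    exact nextPos_prevPos hp

/-- `prevPos (nextPos p) = p` for `p < N`. [folklore] -/
theorem prevPos_nextPos {p : ℕ} (hp : p < N) : prevPos N v (nextPos N v p) = p :=
  ((nextPos_eq_iff (nextPos_lt hp).1 hp).1 rfl).symm

/-- **Invariance under `prevPos` is constancy on the occurrences of each variable**: if
`Y (prevPos p) = Y p` for all `p < N` then `Y` takes the same value at any two positions `< N`
with the same variable (walk down from the larger to the smaller through `prevPos`). [folklore] -/
theorem eq_of_prevPos_invariant {Y : ℕ → Bool} (hY : ∀ p < N, Y (prevPos N v p) = Y p)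
    {p q : ℕ} (hp : p < N) (hq : q < N) (hv : v q = v p) : Y q = Y p := by
  -- symmetric: reduce to `q < p`
  suffices key : ∀ n, ∀ p q, p < N → q < p → v q = v p → p - q ≤ n → Y q = Y p by
    rcases lt_trichotomy q p with h | rfl | h
    · exact key _ p q hp h hv le_rfl
    · rfl
    · exact (key _ q p hq h hv.symm le_rfl).symm
  intro n
  induction n with
  | zero => intro p q _ hqp _ hn; omega
  | succ n ih =>
    intro p q hp hqp hv hn
    obtain ⟨hle, hlt⟩ := le_prevPos_of_lt (N := N) hqp hv
    have hvP := (prevPos_lt (v := v) hp).2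
    rcases hle.eq_or_lt with rfl | hlt'
    · exact hY p hp
    · rw [← hY p hp]
      exact ih (prevPos N v p) q (hlt.trans hp) hlt' (hv.trans hvP.symm) (by omega)

end Scans

/-! ### The equality block and block sums -/

section Blocks

variable {R : Type*} [CommRing R]

/-- **The equality block** `E(a, b, c) = (a,-1,-1,1; 0,b,-1,1; 0,0,c,1; 1,1,1,0)`: three
variables at single sites on the diagonal (distinct rows and columns), constants in `{-1, 0, 1}`,
and `per E(a,b,c) = 1 - a - b - c + ab + ac + bc`, which on Boolean points is the indicator
`[a = b = c]` (found by solving the multilinear coefficient equations; verified below). [folklore] -/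
def e3 (a b c : R) : Matrix (Fin 4) (Fin 4) R :=
  !![a, -1, -1, 1; 0, b, -1, 1; 0, 0, c, 1; 1, 1, 1, 0]

/-- `per E(a,b,c) = 1 - a - b - c + ab + ac + bc`. [folklore] -/
theorem permanent_e3 (a b c : R) :
    (e3 a b c).permanent = 1 - a - b - c + a * b + a * c + b * c := by
  rw [Matrix.permanent_fin_four_row]
  simp [e3]
  ring

/-- The Boolean indicator as a ring element. [folklore] -/
def bval (b : Bool) : R := if b then 1 else 0

/-- `bval true = 1`. [folklore] -/
@[simp] theorem bval_true : (bval true : R) = 1 := rfl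
/-- `bval false = 0`. [folklore] -/
@[simp] theorem bval_false : (bval false : R) = 0 := rfl

/-- **On Boolean points the equality block is the indicator `[a = b = c]`.** [folklore] -/
theorem permanent_e3_bval (a b c : Bool) :
    (e3 (bval a) (bval b) (bval c) : Matrix (Fin 4) (Fin 4) R).permanent =
      if (a = b ∧ b = c) then 1 else 0 := by
  rw [permanent_e3]
  cases a <;> cases b <;> cases c <;> simp

/-- The entries of the equality block at a Boolean point, off the three sites, lie in `{-1, 0, 1}`;
so do all entries of `E(0,0,0)`. [folklore] -/
theorem e3_zero_apply_mem (g g' : Fin 4) :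
    (e3 0 0 0 : Matrix (Fin 4) (Fin 4) R) g g' = -1 ∨ (e3 0 0 0 : Matrix (Fin 4) (Fin 4) R) g g' = 0 ∨
      (e3 0 0 0 : Matrix (Fin 4) (Fin 4) R) g g' = 1 := by
  fin_cases g <;> fin_cases g' <;> simp [e3]

variable {V : Type*}

/-- **Block sum**: the matrix `H` on `V` together with the diagonal blocks `M s`, `s < κ`, on
`κ` groups of `K` new indices (no entries between `V` and the groups or between different
groups). [folklore] -/
def blockSum (H : Matrix V V R) {κ K : ℕ} (M : Fin κ → Matrix (Fin K) (Fin K) R) :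
    Matrix (V ⊕ Fin κ × Fin K) (V ⊕ Fin κ × Fin K) R :=
  fun x y => match x, y with
  | Sum.inl r, Sum.inl c => H r c
  | Sum.inl _, Sum.inr _ => 0
  | Sum.inr _, Sum.inl _ => 0
  | Sum.inr (s, g), Sum.inr (s', g') => if s = s' then M s g g' else 0

section BlockSumEntries

variable (H : Matrix V V R) {κ K : ℕ} (M : Fin κ → Matrix (Fin K) (Fin K) R)

/-- Entries of a block sum, first block. [folklore] -/
@[simp] theorem blockSum_inl_inl (r c : V) : blockSum H M (Sum.inl r) (Sum.inl c) = H r c := rfl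
/-- Entries of a block sum, off-diagonal. [folklore] -/
@[simp] theorem blockSum_inl_inr (r : V) (y : Fin κ × Fin K) : blockSum H M (Sum.inl r) (Sum.inr y) = 0 := rfl
/-- Entries of a block sum, off-diagonal. [folklore] -/
@[simp] theorem blockSum_inr_inl (x : Fin κ × Fin K) (c : V) : blockSum H M (Sum.inr x) (Sum.inl c) = 0 := rfl
/-- Entries of a block sum, the groups. [folklore] -/
@[simp] theorem blockSum_inr_inr (s s' : Fin κ) (g g' : Fin K) :
    blockSum H M (Sum.inr (s, g)) (Sum.inr (s', g')) = if s = s' then M s g g' else 0 := rfl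

end BlockSumEntries

/-- Peeling the last group of a block sum (`slotPeel` of `PermanentBypass.lean`). [folklore] -/
theorem blockSum_submatrix_slotPeel (H : Matrix V V R) {κ K : ℕ} (M : Fin (κ + 1) → Matrix (Fin K) (Fin K) R) :
    (blockSum H M).submatrix (slotPeel V κ K) (slotPeel V κ K) =
      fromBlocks (blockSum H fun s => M (Fin.castSucc s)) 0 0 (M (Fin.last κ)) := by
  ext x y
  rcases x with (r | ⟨s, g⟩) | g <;> rcases y with (c | ⟨s', g'⟩) | g'
  · rfl
  · rfl
  · rfl
  · rfl
  · simp only [submatrix_apply, slotPeel_inl_inr, blockSum_inr_inr, Fin.castSucc_inj, fromBlocks_apply₁₁]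
  · simp [(Fin.castSucc_lt_last s).ne]
  · rfl
  · simp [(Fin.castSucc_lt_last s').ne']
  · simp

/-- **The permanent of a block sum is the product of the permanents.** [folklore] -/
theorem permanent_blockSum [Fintype V] [DecidableEq V] (H : Matrix V V R) {K : ℕ} :
    ∀ {κ : ℕ} (M : Fin κ → Matrix (Fin K) (Fin K) R),
      (blockSum H M).permanent = H.permanent * ∏ s, (M s).permanent
  | 0, M => by
    rw [← permanent_submatrix_equiv (Equiv.sumEmpty V (Fin 0 × Fin K)).symm, Finset.univ_eq_empty,
      Finset.prod_empty, mul_one]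
    congr 1
  | κ + 1, M => by
    rw [← permanent_submatrix_equiv (slotPeel V κ K), blockSum_submatrix_slotPeel,
      permanent_fromBlocks_zero₂₁, permanent_blockSum H (fun s => M (Fin.castSucc s)),
      Fin.prod_univ_castSucc, mul_assoc]

end Blocks

/-! ### The two-site matrix of a 3CNF -/

section TwoSite

variable (φ : CNF ℕ)

/-- The index type of the base matrix: the `7m` nodes of the clause-product matrix and, for each
of the `3m` literal positions, the four indices of its equality block. [cite: Valiant1979, Lemma 3.1] -/
abbrev BaseIdx : Type := Fin (7 * φ.length) ⊕ Fin (φ.length * 3) × Fin 4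

/-- Re-indexing `Fin (7m) ≃ Fin (cnfDim (linCNF φ))`. [folklore] -/
def hIdx : Fin (7 * φ.length) ≃ Fin (cnfDim (linCNF φ)) := finCongr (cnfDim_linCNF φ).symm

/-- **The clause-product block at a Boolean point** `Y ∈ {0,1}^{3m}`: the clause-product matrix of
`linCNF φ` with `Y` substituted, as an integer matrix on `Fin (7m)`. [cite: Valiant1979, Lemma 3.1] -/
def hAt (Y : Fin (φ.length * 3) → Bool) : Matrix (Fin (7 * φ.length)) (Fin (7 * φ.length)) ℤ :=
  fun r c => constPart (boolSubst (cnfMatrix (k := ℤ) (σ := Empty) (linCNF φ)) Y (hIdx φ r) (hIdx φ c))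

/-- The constant clause-product block (all variables read as `0`). [cite: Valiant1979, Lemma 3.1] -/
def h0 : Matrix (Fin (7 * φ.length)) (Fin (7 * φ.length)) ℤ :=
  fun r c => constPart (cnfMatrix (k := ℤ) (σ := Empty) (linCNF φ) (hIdx φ r) (hIdx φ c))

/-- `h0` is `hConst` (the `ℕ`-indexed closed form). [cite: Valiant1979, Lemma 3.1] -/
theorem h0_apply (r c : Fin (7 * φ.length)) : h0 φ r c = hConst φ r.val c.val :=
  constPart_cnfMatrix_linCNF φ _ _

/-- **`per` of the clause-product block at a Boolean point is the satisfaction indicator** of the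
linearised CNF (`CNFPermanent.lean`, read in `ℤ`). [cite: Valiant1979, Lemma 3.1] -/
theorem permanent_hAt (Y : Fin (φ.length * 3) → Bool) :
    (hAt φ Y).permanent = if (linCNF φ).eval Y then 1 else 0 := by
  set N := boolSubst (cnfMatrix (k := ℤ) (σ := Empty) (linCNF φ)) Y with hN
  have h1 : hAt φ Y = (N.map constPart).submatrix (hIdx φ) (hIdx φ) := rfl
  rw [h1, permanent_submatrix_equiv]
  have h2 := entryPer_boolSubst_cnfMatrix (k := ℤ) (σ := Empty) (linCNF φ) Y
  have h3 : entryPer N = MvPolynomial.C ((N.map constPart).permanent) := by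
    unfold entryPer
    rw [← Matrix.permanent_map_ringHom MvPolynomial.C, Matrix.map_map]
    congr 1
    ext r c
    simp only [Matrix.map_apply, Function.comp_apply]
    rcases N r c with z | e
    · rfl
    · exact e.elim
  rw [h3] at h2
  have h4 : (if (linCNF φ).eval Y then (1 : MvPolynomial Empty ℤ) else 0) =
      MvPolynomial.C (if (linCNF φ).eval Y then 1 else 0) := by
    split_ifs <;> simp
  rw [h4] at h2
  exact MvPolynomial.C_injective _ _ h2

/-- The clause-product block at a Boolean point: the constants, plus `[Y_p]` at each diagonal site. [cite: Valiant1979, Lemma 3.1] -/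
theorem hAt_apply (Y : Fin (φ.length * 3) → Bool) (r c : Fin (7 * φ.length)) :
    hAt φ Y r c = h0 φ r c + ∑ p : Fin (φ.length * 3),
      if (Y p ∧ r.val = sPos p.val ∧ c.val = sPos p.val) then 1 else 0 := by
  unfold hAt h0 boolSubst
  rw [Matrix.map_apply]
  by_cases hs : ∃ p : Fin (φ.length * 3), r.val = sPos p.val ∧ c.val = sPos p.val
  · obtain ⟨p, hr, hc⟩ := hs
    have hM : cnfMatrix (k := ℤ) (σ := Empty) (linCNF φ) (hIdx φ r) (hIdx φ c) = Sum.inr (Sum.inr p) :=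
      (cnfMatrix_linCNF_eq_inr_iff φ _ _ _).2 ⟨p, rfl, hr, hc⟩
    rw [hM, Finset.sum_eq_single p]
    · simp only [boolSubstEntry, constPart_inl, constPart_inr, zero_add, hr, hc, and_self, and_true]
    · intro q _ hq
      rw [if_neg]
      rintro ⟨-, hq1, -⟩
      exact hq (Fin.ext (sPos_injective (hq1.symm.trans hr)))
    · simp
  · have h0' : ∀ p : Fin (φ.length * 3), ¬ (Y p ∧ r.val = sPos p.val ∧ c.val = sPos p.val) :=
      fun p hp => hs ⟨p, hp.2.1, hp.2.2⟩
    simp only [h0', if_false, Finset.sum_const_zero, add_zero]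
    rcases hM : cnfMatrix (k := ℤ) (σ := Empty) (linCNF φ) (hIdx φ r) (hIdx φ c) with z | y
    · rfl
    · obtain ⟨p, -, hr, hc⟩ := (cnfMatrix_linCNF_eq_inr_iff φ _ _ _).1 hM
      exact absurd ⟨p, hr, hc⟩ hs

/-- **The base matrix** of the 3CNF: the constant clause-product block together with `3m`
constant equality blocks `E(0,0,0)`; entries in `{-1, 0, 1}`. [cite: Valiant1979, Lemma 3.1] -/
def baseMatrix : Matrix (BaseIdx φ) (BaseIdx φ) ℤ :=
  blockSum (h0 φ) fun _ : Fin (φ.length * 3) => e3 0 0 0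

/-- The entries of the base matrix lie in `{-1, 0, 1}`. [cite: Valiant1979, Lemma 3.1] -/
theorem baseMatrix_apply_mem (x y : BaseIdx φ) :
    baseMatrix φ x y = -1 ∨ baseMatrix φ x y = 0 ∨ baseMatrix φ x y = 1 := by
  rcases x with r | ⟨p, g⟩ <;> rcases y with c | ⟨p', g'⟩
  · rw [baseMatrix, blockSum_inl_inl, h0_apply]; exact hConst_mem φ _ _
  · simp [baseMatrix]
  · simp [baseMatrix]
  · rw [baseMatrix, blockSum_inr_inr]
    split_ifs
    · exact e3_zero_apply_mem g g'
    · simp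

/-- The next occurrence as a map of positions `Fin (3m)`. [cite: Valiant1979, Lemma 3.1] -/
def nextFin (p : Fin (φ.length * 3)) : Fin (φ.length * 3) :=
  ⟨nextPos (φ.length * 3) (varAt φ) p, (nextPos_lt p.isLt).1⟩

/-- The previous occurrence as a map of positions `Fin (3m)`. [cite: Valiant1979, Lemma 3.1] -/
def prevFin' (p : Fin (φ.length * 3)) : Fin (φ.length * 3) := prevFin (v := varAt φ) p

/-- **The two sites of the clause variable `Y_p`**: the diagonal site `sPos p` of the
clause-product block and the slot `1` of the equality block `p` (coefficients `1`). [cite: Valiant1979, Lemma 3.1] -/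
def siteY (p : Fin (φ.length * 3)) : SitePair (BaseIdx φ) ℤ where
  u₁ := Sum.inl ⟨sPos p, sPos_lt p.isLt⟩
  v₁ := Sum.inl ⟨sPos p, sPos_lt p.isLt⟩
  u₂ := Sum.inr (p, 1)
  v₂ := Sum.inr (p, 1)
  ε₁ := 1
  ε₂ := 1
  hu := Sum.inl_ne_inr
  hv := Sum.inl_ne_inr

/-- **The two sites of the chain variable `U_p`**: the slot `2` of the equality block `p` and the
slot `0` of the equality block of the NEXT occurrence of the same variable (coefficients `1`). [cite: Valiant1979, Lemma 3.1] -/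
def siteU (p : Fin (φ.length * 3)) : SitePair (BaseIdx φ) ℤ where
  u₁ := Sum.inr (p, 2)
  v₁ := Sum.inr (p, 2)
  u₂ := Sum.inr (nextFin φ p, 0)
  v₂ := Sum.inr (nextFin φ p, 0)
  ε₁ := 1
  ε₂ := 1
  hu := by simp
  hv := by simp

/-- All `6m` site pairs: first the `Y_p`, then the `U_p`. [cite: Valiant1979, Lemma 3.1] -/
def sites (j : Fin (φ.length * 3 + φ.length * 3)) : SitePair (BaseIdx φ) ℤ :=
  Sum.elim (siteY φ) (siteU φ) (finSumFinEquiv.symm j)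

/-- The `Y`-part of a Boolean point of the `6m` variables. [folklore] -/
def yOf (b : Fin (φ.length * 3 + φ.length * 3) → Bool) (p : Fin (φ.length * 3)) : Bool :=
  b (finSumFinEquiv (Sum.inl p))

/-- The `U`-part of a Boolean point of the `6m` variables. [folklore] -/
def uOf (b : Fin (φ.length * 3 + φ.length * 3) → Bool) (p : Fin (φ.length * 3)) : Bool :=
  b (finSumFinEquiv (Sum.inr p))

/-- The equality block in terms of `E(0,0,0)` and its three diagonal sites. [folklore] -/
theorem e3_eq_add_sites (a b c : ℤ) (g g' : Fin 4) :
    e3 a b c g g' = e3 0 0 0 g g' + (if g = 0 ∧ g' = 0 then a else 0) +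
      (if g = 1 ∧ g' = 1 then b else 0) + (if g = 2 ∧ g' = 2 then c else 0) := by
  fin_cases g <;> fin_cases g' <;> simp [e3]

/-- **The matrix at a Boolean point `(Y, U)`** is the block sum of the clause-product block at `Y`
and the equality blocks `E(U_{prev p}, Y_p, U_p)`. [cite: Valiant1979, Lemma 3.1] -/
theorem sitePoint_baseMatrix (b : Fin (φ.length * 3 + φ.length * 3) → Bool) :
    sitePoint (baseMatrix φ) (sites φ) b =
      blockSum (hAt φ (yOf φ b)) fun p =>
        e3 (bval (uOf φ b (prevFin' φ p))) (bval (yOf φ b p)) (bval (uOf φ b p)) := by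
  -- the contributions of the `Y`-sites and of the `U`-sites at an entry `(x, y)`
  set Y := yOf φ b with hYd
  set U := uOf φ b with hUd
  have fy : ∀ p, b (finSumFinEquiv (Sum.inl p)) = Y p := fun _ => rfl
  have fu : ∀ p, b (finSumFinEquiv (Sum.inr p)) = U p := fun _ => rfl
  let TY : BaseIdx φ → BaseIdx φ → Fin (φ.length * 3) → ℤ := fun x y p =>
    if Y p = true then
      ((if (siteY φ p).u₁ = x ∧ (siteY φ p).v₁ = y then (siteY φ p).ε₁ else 0) +
        (if (siteY φ p).u₂ = x ∧ (siteY φ p).v₂ = y then (siteY φ p).ε₂ else 0)) else 0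
  let TU : BaseIdx φ → BaseIdx φ → Fin (φ.length * 3) → ℤ := fun x y p =>
    if U p = true then
      ((if (siteU φ p).u₁ = x ∧ (siteU φ p).v₁ = y then (siteU φ p).ε₁ else 0) +
        (if (siteU φ p).u₂ = x ∧ (siteU φ p).v₂ = y then (siteU φ p).ε₂ else 0)) else 0
  have key : ∀ x y, sitePoint (baseMatrix φ) (sites φ) b x y =
      baseMatrix φ x y + (∑ p, TY x y p + ∑ p, TU x y p) := by
    intro x y
    rw [sitePoint_apply, ← Equiv.sum_comp finSumFinEquiv, Fintype.sum_sum_type]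
    simp only [sites, Equiv.symm_apply_apply, Sum.elim_inl, Sum.elim_inr, fy, fu]
    rfl
  -- `Y`-sites: diagonal of the clause block, slot `1` of the equality blocks
  have hY_ll : ∀ r c : Fin (7 * φ.length), ∑ p, TY (Sum.inl r) (Sum.inl c) p =
      ∑ p : Fin (φ.length * 3), if (Y p ∧ r.val = sPos p.val ∧ c.val = sPos p.val) then 1 else 0 := by
    intro r c
    refine Finset.sum_congr rfl fun p _ => ?_
    simp only [TY, siteY, Sum.inl.injEq, reduceCtorEq, false_and, if_false, add_zero, Fin.ext_iff]
    by_cases hb : Y p = true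
    · simp only [hb, if_true, true_and]
      by_cases h : sPos p.val = r.val ∧ sPos p.val = c.val
      · rw [if_pos h, if_pos ⟨h.1.symm, h.2.symm⟩]
      · rw [if_neg h, if_neg (fun h' => h ⟨h'.1.symm, h'.2.symm⟩)]
    · simp [hb]
  have hY_rr : ∀ (p₁ p₂ : Fin (φ.length * 3)) (g₁ g₂ : Fin 4), ∑ p, TY (Sum.inr (p₁, g₁)) (Sum.inr (p₂, g₂)) p =
      if (p₁ = p₂ ∧ g₁ = 1 ∧ g₂ = 1) then bval (Y p₁) else 0 := by
    intro p₁ p₂ g₁ g₂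
    rw [Finset.sum_eq_single p₁]
    · simp only [TY, siteY, reduceCtorEq, false_and, if_false, zero_add, Sum.inr.injEq, Prod.mk.injEq, true_and]
      unfold bval
      by_cases h1 : Y p₁ = true
      · simp only [h1, if_true]
        by_cases hg : p₁ = p₂ ∧ g₁ = 1 ∧ g₂ = 1
        · rw [if_pos hg, if_pos ⟨hg.2.1.symm, hg.1, hg.2.2.symm⟩]
        · rw [if_neg hg, if_neg (fun h => hg ⟨h.2.1, h.1.symm, h.2.2.symm⟩)]
      · simp [h1]
    · intro p _ hpne
      simp [TY, siteY, hpne]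
    · simp
  -- `U`-sites: slots `2` (own block) and `0` (block of the next occurrence)
  have hU_rr : ∀ (p₁ p₂ : Fin (φ.length * 3)) (g₁ g₂ : Fin 4), ∑ p, TU (Sum.inr (p₁, g₁)) (Sum.inr (p₂, g₂)) p =
      (if (p₁ = p₂ ∧ g₁ = 2 ∧ g₂ = 2) then bval (U p₁) else 0) +
        (if (p₁ = p₂ ∧ g₁ = 0 ∧ g₂ = 0) then bval (U (prevFin' φ p₁)) else 0) := by
    intro p₁ p₂ g₁ g₂
    have split : ∀ p : Fin (φ.length * 3), TU (Sum.inr (p₁, g₁)) (Sum.inr (p₂, g₂)) p =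
        (if (U p = true ∧ p = p₁ ∧ p = p₂ ∧ g₁ = 2 ∧ g₂ = 2) then 1 else 0) +
          (if (U p = true ∧ nextFin φ p = p₁ ∧ nextFin φ p = p₂ ∧ g₁ = 0 ∧ g₂ = 0) then 1 else 0) := by
      intro p
      by_cases hu : U p = true
      · have e1 : (if (siteU φ p).u₁ = Sum.inr (p₁, g₁) ∧ (siteU φ p).v₁ = Sum.inr (p₂, g₂) then (siteU φ p).ε₁ else 0)
            = if (U p = true ∧ p = p₁ ∧ p = p₂ ∧ g₁ = 2 ∧ g₂ = 2) then (1 : ℤ) else 0 := by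
          simp only [siteU, Sum.inr.injEq, Prod.mk.injEq, hu, true_and]
          by_cases h : p = p₁ ∧ p = p₂ ∧ g₁ = 2 ∧ g₂ = 2
          · rw [if_pos h, if_pos ⟨⟨h.1, h.2.2.1.symm⟩, h.2.1, h.2.2.2.symm⟩]
          · rw [if_neg h, if_neg (fun h' => h ⟨h'.1.1, h'.2.1, h'.1.2.symm, h'.2.2.symm⟩)]
        have e2 : (if (siteU φ p).u₂ = Sum.inr (p₁, g₁) ∧ (siteU φ p).v₂ = Sum.inr (p₂, g₂) then (siteU φ p).ε₂ else 0)
            = if (U p = true ∧ nextFin φ p = p₁ ∧ nextFin φ p = p₂ ∧ g₁ = 0 ∧ g₂ = 0) then (1 : ℤ) else 0 := by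
          simp only [siteU, Sum.inr.injEq, Prod.mk.injEq, hu, true_and]
          by_cases h : nextFin φ p = p₁ ∧ nextFin φ p = p₂ ∧ g₁ = 0 ∧ g₂ = 0
          · rw [if_pos h, if_pos ⟨⟨h.1, h.2.2.1.symm⟩, h.2.1, h.2.2.2.symm⟩]
          · rw [if_neg h, if_neg (fun h' => h ⟨h'.1.1, h'.2.1, h'.1.2.symm, h'.2.2.symm⟩)]
        simp only [TU]
        rw [if_pos hu, e1, e2]
      · simp [TU, hu]
    simp only [split, Finset.sum_add_distrib]
    congr 1
    · rw [Finset.sum_eq_single p₁ (fun p _ hp => by simp [hp]) (by simp)]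
      unfold bval
      by_cases hu : U p₁ = true <;> by_cases hg : p₁ = p₂ ∧ g₁ = 2 ∧ g₂ = 2 <;> simp [hu, hg]
    · rw [Finset.sum_eq_single (prevFin' φ p₁) ?_ (by simp)]
      · have hn : nextFin φ (prevFin' φ p₁) = p₁ := Fin.ext (nextPos_prevPos p₁.isLt)
        simp only [hn]
        unfold bval
        by_cases hu : U (prevFin' φ p₁) = true <;> by_cases hg : p₁ = p₂ ∧ g₁ = 0 ∧ g₂ = 0 <;> simp [hu, hg]
      · intro p _ hp
        have hn : nextFin φ p ≠ p₁ := fun h =>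
          hp (Fin.ext ((nextPos_eq_iff p₁.isLt p.isLt).1 (congrArg Fin.val h)))
        simp [hn]
  ext x y
  rw [key]
  rcases x with r | ⟨p₁, g₁⟩ <;> rcases y with c | ⟨p₂, g₂⟩
  · -- inside the clause-product block
    have hU0 : ∑ p, TU (Sum.inl r) (Sum.inl c) p = 0 := Finset.sum_eq_zero fun p _ => by simp [TU, siteU]
    rw [hU0, add_zero, hY_ll, blockSum_inl_inl, hAt_apply, baseMatrix, blockSum_inl_inl]
  · have h1 : ∑ p, TY (Sum.inl r) (Sum.inr (p₂, g₂)) p = 0 := Finset.sum_eq_zero fun p _ => by simp [TY, siteY]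
    have h2 : ∑ p, TU (Sum.inl r) (Sum.inr (p₂, g₂)) p = 0 := Finset.sum_eq_zero fun p _ => by simp [TU, siteU]
    rw [h1, h2, add_zero, add_zero, blockSum_inl_inr, baseMatrix, blockSum_inl_inr]
  · have h1 : ∑ p, TY (Sum.inr (p₁, g₁)) (Sum.inl c) p = 0 := Finset.sum_eq_zero fun p _ => by simp [TY, siteY]
    have h2 : ∑ p, TU (Sum.inr (p₁, g₁)) (Sum.inl c) p = 0 := Finset.sum_eq_zero fun p _ => by simp [TU, siteU]
    rw [h1, h2, add_zero, add_zero, blockSum_inr_inl, baseMatrix, blockSum_inr_inl]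
  · -- inside the equality blocks
    rw [blockSum_inr_inr, baseMatrix, blockSum_inr_inr, hY_rr, hU_rr]
    by_cases hp : p₁ = p₂
    · subst hp
      simp only [if_true, true_and, e3_eq_add_sites (bval _)]
      ring
    · rw [if_neg hp, if_neg hp, if_neg (fun h => hp h.1), if_neg (fun h => hp h.1), if_neg (fun h => hp h.1)]
      simp

/-- **The permanent at a Boolean point** `(Y, U)`: the satisfaction indicator of the linearised
CNF at `Y` times the consistency indicators `[U_{prev p} = Y_p = U_p]` of all positions. [cite: Valiant1979, Lemma 3.1] -/
theorem permanent_sitePoint_baseMatrix (b : Fin (φ.length * 3 + φ.length * 3) → Bool) :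
    (sitePoint (baseMatrix φ) (sites φ) b).permanent =
      (if (linCNF φ).eval (yOf φ b) then 1 else 0) *
        ∏ p : Fin (φ.length * 3),
          (if (uOf φ b (prevFin' φ p) = yOf φ b p ∧ yOf φ b p = uOf φ b p) then 1 else 0) := by
  rw [sitePoint_baseMatrix, permanent_blockSum, permanent_hAt]
  simp only [permanent_e3_bval]

end TwoSite

/-! ### The Boolean sum counts the satisfying assignments -/

section Count

variable (φ : CNF ℕ)

/-- Splitting a Boolean point of the `6m` variables into its `Y`- and `U`-parts. [folklore] -/
def splitEquiv : (Fin (φ.length * 3 + φ.length * 3) → Bool) ≃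
    (Fin (φ.length * 3) → Bool) × (Fin (φ.length * 3) → Bool) :=
  (Equiv.arrowCongr finSumFinEquiv.symm (Equiv.refl Bool)).trans (Equiv.sumArrowEquivProdArrow _ _ _)

/-- The split is `(yOf, uOf)`. [folklore] -/
theorem splitEquiv_apply (b : Fin (φ.length * 3 + φ.length * 3) → Bool) :
    splitEquiv φ b = (yOf φ b, uOf φ b) := rfl

/-- **Summing out the chain variables**: for fixed `Y`, exactly one `U` makes all equality
blocks `1` if `Y` is invariant under `prevPos` (namely `U = Y`), and none otherwise. [cite: Valiant1979, Lemma 3.1] -/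
theorem sum_prod_consistency (Y : Fin (φ.length * 3) → Bool) :
    ∑ U : Fin (φ.length * 3) → Bool, ∏ p : Fin (φ.length * 3),
        (if (U (prevFin' φ p) = Y p ∧ Y p = U p) then (1 : ℤ) else 0) =
      if (∀ p, Y (prevFin' φ p) = Y p) then 1 else 0 := by
  have hc : ∀ U : Fin (φ.length * 3) → Bool,
      (∀ p, U (prevFin' φ p) = Y p ∧ Y p = U p) ↔ (U = Y ∧ ∀ p, Y (prevFin' φ p) = Y p) := by
    intro U
    constructor
    · intro h
      obtain rfl : U = Y := funext fun p => (h p).2.symm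
      exact ⟨rfl, fun p => (h p).1⟩
    · rintro ⟨rfl, h⟩ p
      exact ⟨h p, rfl⟩
  simp_rw [Fintype.prod_boole, hc, ite_and]
  rw [Finset.sum_ite_eq']
  simp

/-- **The variables of `φ` are the variables of its literal positions** (`φ` a 3CNF). [folklore] -/
theorem mem_vars_iff (hφ : CNF.IsWidthEq 3 φ) (v : ℕ) :
    v ∈ φ.vars ↔ ∃ p, p < φ.length * 3 ∧ varAt φ p = v := by
  unfold CNF.vars varAt litAt
  rw [List.mem_toFinset, List.mem_map]
  constructor
  · rintro ⟨lit, hlit, rfl⟩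
    rw [List.mem_flatten] at hlit
    obtain ⟨cl, hcl, hl⟩ := hlit
    obtain ⟨c, hc, rfl⟩ := List.mem_iff_getElem.1 hcl
    obtain ⟨l, hl3, rfl⟩ := List.mem_iff_getElem.1 hl
    have hlen : (φ[c]).length = 3 := hφ _ hcl
    refine ⟨c * 3 + l, by omega, ?_⟩
    have e1 : (c * 3 + l) / 3 = c := by omega
    have e2 : (c * 3 + l) % 3 = l := by omega
    rw [e1, e2, List.getD_eq_getElem _ _ hc, List.getD_eq_getElem _ _ hl3]
  · rintro ⟨p, hp, rfl⟩
    have hc : p / 3 < φ.length := by omega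
    have hcl : φ[p / 3] ∈ φ := List.getElem_mem hc
    have hlen : (φ[p / 3]).length = 3 := hφ _ hcl
    have hl : p % 3 < (φ[p / 3]).length := by omega
    refine ⟨(φ[p / 3])[p % 3], List.mem_flatten.2 ⟨_, hcl, List.getElem_mem hl⟩, ?_⟩
    rw [List.getD_eq_getElem _ _ hc, List.getD_eq_getElem _ _ hl]

/-- The clause `c` of a 3CNF is the list of its three literals `litAt φ c 0, 1, 2`. [folklore] -/
theorem getElem_eq_litAt (hφ : CNF.IsWidthEq 3 φ) {c : ℕ} (hc : c < φ.length) :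
    φ[c] = [litAt φ c 0, litAt φ c 1, litAt φ c 2] := by
  have hlen : (φ[c]).length = 3 := hφ _ (List.getElem_mem hc)
  unfold litAt
  rw [List.getD_eq_getElem _ _ hc]
  generalize φ[c] = cl at hlen ⊢
  match cl, hlen with
  | [a, b, d], _ => rfl

/-- The variable of the position `finProdFinEquiv (c, l)` is that of `litAt φ c l`. [folklore] -/
theorem varAt_finProdFinEquiv (c : Fin φ.length) (l : Fin 3) :
    varAt φ (finProdFinEquiv (c, l) : Fin (φ.length * 3)) = (litAt φ c l).1 := by
  unfold varAt
  rw [val_finProdFinEquiv]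
  have e1 : (l.val + 3 * c.val) / 3 = c := by omega
  have e2 : (l.val + 3 * c.val) % 3 = l := by omega
  rw [e1, e2]

/-- **The linearised CNF read through the variable map is `φ`**: for an assignment `τ` of the
variables of `φ`, `linCNF φ` at `Y_p := τ (varAt p)` has the value of `φ` at `τ` (`φ` a 3CNF). [cite: Valiant1979, Lemma 3.1] -/
theorem eval_linCNF_comp_varAt (hφ : CNF.IsWidthEq 3 φ) (τ : ℕ → Bool) :
    (linCNF φ).eval (fun p => τ (varAt φ p)) = φ.eval τ := by
  rw [Bool.eq_iff_iff, CNF.eval_eq_true_iff, CNF.eval_eq_true_iff]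
  have key : ∀ c : Fin φ.length,
      Clause.eval (fun p : Fin (φ.length * 3) => τ (varAt φ p))
          (List.ofFn fun l : Fin 3 => (finProdFinEquiv (c, l), (litAt φ c l).2)) = true ↔
        Clause.eval τ (φ[c.val]) = true := by
    intro c
    rw [getElem_eq_litAt φ hφ c.isLt]
    simp only [Clause.eval, List.any_eq_true, List.mem_ofFn, Literal.eval]
    constructor
    · rintro ⟨_, ⟨l, rfl⟩, h⟩
      rw [varAt_finProdFinEquiv] at h
      refine ⟨litAt φ c l, ?_, h⟩
      fin_cases l <;> simp
    · rintro ⟨lit, hmem, h⟩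
      simp only [List.mem_cons, List.not_mem_nil, or_false] at hmem
      rcases hmem with rfl | rfl | rfl
      · exact ⟨_, ⟨0, rfl⟩, by rw [varAt_finProdFinEquiv]; exact h⟩
      · exact ⟨_, ⟨1, rfl⟩, by rw [varAt_finProdFinEquiv]; exact h⟩
      · exact ⟨_, ⟨2, rfl⟩, by rw [varAt_finProdFinEquiv]; exact h⟩
  constructor
  · intro h cl hcl
    obtain ⟨c, hc, rfl⟩ := List.mem_iff_getElem.1 hcl
    exact (key ⟨c, hc⟩).1 (h _ (by rw [linCNF, List.mem_ofFn]; exact ⟨⟨c, hc⟩, rfl⟩))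
  · intro h cl hcl
    rw [linCNF, List.mem_ofFn] at hcl
    obtain ⟨c, rfl⟩ := hcl
    exact (key c).2 (h _ (List.getElem_mem c.isLt))

/-- The assignment of the positions induced by an assignment of the variables of `φ`. [folklore] -/
def toY (σ : φ.vars → Bool) : Fin (φ.length * 3) → Bool :=
  fun p => φ.extendAssignment σ (varAt φ p)

/-- A position of an occurring variable (the least one). [folklore] -/
def posOf (hφ : CNF.IsWidthEq 3 φ) (v : φ.vars) : Fin (φ.length * 3) :=
  ⟨Nat.find ((mem_vars_iff φ hφ v.1).1 v.2), (Nat.find_spec ((mem_vars_iff φ hφ v.1).1 v.2)).1⟩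

/-- `posOf v` is a position of `v`. [folklore] -/
theorem varAt_posOf (hφ : CNF.IsWidthEq 3 φ) (v : φ.vars) : varAt φ (posOf φ hφ v) = v.1 :=
  (Nat.find_spec ((mem_vars_iff φ hφ v.1).1 v.2)).2

/-- The assignment of the variables of `φ` read off an assignment of the positions. [folklore] -/
def toσ (hφ : CNF.IsWidthEq 3 φ) (Y : Fin (φ.length * 3) → Bool) : φ.vars → Bool :=
  fun v => Y (posOf φ hφ v)

/-- `linCNF φ` at `toY σ` has the value of `φ` at `σ` (extended by `false`). [cite: Valiant1979, Lemma 3.1] -/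
theorem eval_linCNF_toY (hφ : CNF.IsWidthEq 3 φ) (σ : φ.vars → Bool) :
    (linCNF φ).eval (toY φ σ) = φ.eval (φ.extendAssignment σ) :=
  eval_linCNF_comp_varAt φ hφ _

/-- `toY σ` is invariant under `prevPos` (it only depends on the variable of a position). [folklore] -/
theorem toY_prevFin' (σ : φ.vars → Bool) (p : Fin (φ.length * 3)) :
    toY φ σ (prevFin' φ p) = toY φ σ p := by
  unfold toY prevFin' prevFin
  dsimp only
  rw [(prevPos_lt (N := φ.length * 3) (v := varAt φ) p.isLt).2]

/-- `toσ (toY σ) = σ`. [folklore] -/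
theorem toσ_toY (hφ : CNF.IsWidthEq 3 φ) (σ : φ.vars → Bool) : toσ φ hφ (toY φ σ) = σ := by
  funext v
  unfold toσ toY CNF.extendAssignment
  rw [varAt_posOf, dif_pos v.2]

/-- `toY (toσ Y) = Y` for `Y` invariant under `prevPos`. [folklore] -/
theorem toY_toσ (hφ : CNF.IsWidthEq 3 φ) {Y : Fin (φ.length * 3) → Bool}
    (hY : ∀ p, Y (prevFin' φ p) = Y p) : toY φ (toσ φ hφ Y) = Y := by
  funext p
  have hv : varAt φ p ∈ φ.vars := (mem_vars_iff φ hφ _).2 ⟨p, p.isLt, rfl⟩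
  unfold toY CNF.extendAssignment toσ
  rw [dif_pos hv]
  -- class constancy from invariance
  let Y' : ℕ → Bool := fun n => if h : n < φ.length * 3 then Y ⟨n, h⟩ else false
  have hY' : ∀ q < φ.length * 3, Y' (prevPos (φ.length * 3) (varAt φ) q) = Y' q := by
    intro q hq
    have h := hY ⟨q, hq⟩
    simp only [Y', dif_pos hq, dif_pos (prevPos_lt (v := varAt φ) hq).1]
    exact h
  have key := eq_of_prevPos_invariant hY' (posOf φ hφ ⟨varAt φ p, hv⟩).isLt p.isLt
    (varAt_posOf φ hφ ⟨varAt φ p, hv⟩).symm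
  simp only [Y', dif_pos p.isLt, dif_pos (posOf φ hφ ⟨varAt φ p, hv⟩).isLt] at key
  exact key.symm

/-- **The Boolean sum of the permanents is the number of satisfying assignments of `φ`**
(`φ` a 3CNF; `CNF.numSat`: assignments of the occurring variables). [cite: Valiant1979, Lemma 3.1] -/
theorem sum_permanent_sitePoint (hφ : CNF.IsWidthEq 3 φ) :
    ∑ b, (sitePoint (baseMatrix φ) (sites φ) b).permanent = (φ.numSat : ℤ) := by
  simp_rw [permanent_sitePoint_baseMatrix]
  rw [Fintype.sum_equiv (splitEquiv φ)
      (fun b => (if (linCNF φ).eval (yOf φ b) then (1 : ℤ) else 0) *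
        ∏ p : Fin (φ.length * 3), (if (uOf φ b (prevFin' φ p) = yOf φ b p ∧ yOf φ b p = uOf φ b p) then (1 : ℤ) else 0))
      (fun q => (if (linCNF φ).eval q.1 then (1 : ℤ) else 0) *
        ∏ p : Fin (φ.length * 3), (if (q.2 (prevFin' φ p) = q.1 p ∧ q.1 p = q.2 p) then (1 : ℤ) else 0))
      (fun b => rfl), Fintype.sum_prod_type]
  have step : ∑ Y : Fin (φ.length * 3) → Bool, ∑ U : Fin (φ.length * 3) → Bool,
      (fun q : (Fin (φ.length * 3) → Bool) × (Fin (φ.length * 3) → Bool) =>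
        (if (linCNF φ).eval q.1 then (1 : ℤ) else 0) *
          ∏ p : Fin (φ.length * 3), (if (q.2 (prevFin' φ p) = q.1 p ∧ q.1 p = q.2 p) then (1 : ℤ) else 0)) (Y, U) =
      ∑ Y : Fin (φ.length * 3) → Bool,
        (if (linCNF φ).eval Y then (1 : ℤ) else 0) * (if (∀ p, Y (prevFin' φ p) = Y p) then 1 else 0) :=
    Finset.sum_congr rfl fun Y _ => by
      dsimp only
      rw [← sum_prod_consistency φ Y, Finset.mul_sum]
  rw [step]
  have hmul : ∀ Y : Fin (φ.length * 3) → Bool,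
      ((if (linCNF φ).eval Y then (1 : ℤ) else 0) * if (∀ p, Y (prevFin' φ p) = Y p) then 1 else 0) =
        if ((linCNF φ).eval Y = true ∧ ∀ p, Y (prevFin' φ p) = Y p) then 1 else 0 := by
    intro Y
    by_cases h1 : (linCNF φ).eval Y = true <;> by_cases h2 : (∀ p, Y (prevFin' φ p) = Y p) <;> simp [h1, h2]
  simp_rw [hmul]
  rw [Finset.sum_boole, CNF.numSat]
  congr 1
  refine Finset.card_bij' (fun Y _ => toσ φ hφ Y) (fun σ _ => toY φ σ) ?_ ?_ ?_ ?_
  · intro Y hY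
    rw [Finset.mem_filter] at hY ⊢
    refine ⟨Finset.mem_univ _, ?_⟩
    have h := hY.2.1
    rw [← toY_toσ φ hφ hY.2.2] at h
    rwa [eval_linCNF_toY φ hφ] at h
  · intro σ hσ
    rw [Finset.mem_filter] at hσ ⊢
    refine ⟨Finset.mem_univ _, ?_, toY_prevFin' φ σ⟩
    rw [eval_linCNF_toY φ hφ]
    exact hσ.2
  · intro Y hY
    rw [Finset.mem_filter] at hY
    exact toY_toσ φ hφ hY.2.2
  · intro σ _
    exact toσ_toY φ hφ σ

end Count

/-! ### The single integer permanent -/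

section Main

variable (φ : CNF ℕ)

/-- The entries of the two-site core lie in `{-1, 0, 1}`. [folklore] -/
theorem boolSumCore_apply_mem (g g' : Fin 4) :
    (boolSumCore g g' : ℤ) = -1 ∨ (boolSumCore g g' : ℤ) = 0 ∨ (boolSumCore g g' : ℤ) = 1 := by
  fin_cases g <;> fin_cases g' <;> simp [boolSumCore]

/-- **Entries of the all-at-once gadget**: if `A` has entries in `{-1, 0, 1}` and all site
coefficients are `1`, then `glueAll A s` has entries in `{-1, 0, 1}`. [folklore] -/
theorem glueAll_apply_mem {ι : Type u} [DecidableEq ι] (A : Matrix ι ι ℤ)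
    (hA : ∀ x y, A x y = -1 ∨ A x y = 0 ∨ A x y = 1) {T : ℕ} (s : Fin T → SitePair ι ℤ)
    (hs : ∀ k, (s k).ε₁ = 1 ∧ (s k).ε₂ = 1) (x y : ι ⊕ Fin T × Fin 4) :
    glueAll A s x y = -1 ∨ glueAll A s x y = 0 ∨ glueAll A s x y = 1 := by
  rcases x with j | ⟨k, g⟩ <;> rcases y with i | ⟨k', g'⟩
  · exact hA j i
  · rw [glueAll_inl_inr]
    split_ifs
    · simp [(hs k').1]
    · simp [(hs k').2]
    · simp
  · rw [glueAll_inr_inl]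
    split_ifs <;> simp
  · rw [glueAll_inr_inr]
    split_ifs
    · exact boolSumCore_apply_mem g g'
    · simp

/-- All site coefficients of the 3CNF are `1`. [folklore] -/
theorem sites_eps (k : Fin (φ.length * 3 + φ.length * 3)) : (sites φ k).ε₁ = 1 ∧ (sites φ k).ε₂ = 1 := by
  unfold sites
  rcases finSumFinEquiv.symm k with p | p <;> simp [siteY, siteU]

/-- **The two-site matrix of a 3CNF**: the all-at-once gadget of the base matrix along its `6m`
site pairs — an explicit square integer matrix on `BaseIdx φ ⊕ Fin 6m × Fin 4` (size `43m`)
with entries in `{-1, 0, 1}`. [cite: Valiant1979, Lemma 3.1] -/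
def twoSiteMatrix : Matrix (BaseIdx φ ⊕ Fin (φ.length * 3 + φ.length * 3) × Fin 4)
    (BaseIdx φ ⊕ Fin (φ.length * 3 + φ.length * 3) × Fin 4) ℤ :=
  glueAll (baseMatrix φ) (sites φ)

/-- The entries of the two-site matrix lie in `{-1, 0, 1}`. [cite: Valiant1979, Lemma 3.1] -/
theorem twoSiteMatrix_apply_mem (x y : BaseIdx φ ⊕ Fin (φ.length * 3 + φ.length * 3) × Fin 4) :
    twoSiteMatrix φ x y = -1 ∨ twoSiteMatrix φ x y = 0 ∨ twoSiteMatrix φ x y = 1 :=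
  glueAll_apply_mem _ (baseMatrix_apply_mem φ) _ (sites_eps φ) x y

/-- **Valiant's Lemma 3.1 in two-site form: `per (twoSiteMatrix φ) = 2^{6m} · #SAT(φ)`** for a
3CNF `φ` with `m` clauses (`CNF.numSat`: the number of satisfying assignments of the occurring
variables). Valiant 1979, Lemma 3.1: "there is an `f ∈ FP` from CNF formulae to matrices with
entries from `{-1, 0, 1, 2, 3}` such that `Perm f(F) = 4^{t(F)} · s(F)`"; here the entries are in
`{-1, 0, 1}` and the factor is `2^{6m}` (one factor `2` per two-site variable,
`permanent_glueAll`). [cite: Valiant1979, Lemma 3.1] -/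
theorem permanent_twoSiteMatrix (hφ : CNF.IsWidthEq 3 φ) :
    (twoSiteMatrix φ).permanent = 2 ^ (φ.length * 3 + φ.length * 3) * (φ.numSat : ℤ) := by
  rw [twoSiteMatrix, permanent_glueAll, sum_permanent_sitePoint φ hφ]

/-- A 3CNF with `m` clauses has at most `3m` variables. [folklore] -/
theorem card_vars_le (hφ : CNF.IsWidthEq 3 φ) : φ.vars.card ≤ φ.length * 3 := by
  unfold CNF.vars
  refine (List.toFinset_card_le _).trans ?_
  rw [List.length_map, List.length_flatten]
  have : φ.map List.length = φ.map (fun _ => 3) := List.map_congr_left fun c hc => hφ c hc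
  rw [this, List.map_const', List.sum_replicate, smul_eq_mul]

/-- **`#SAT(φ) ≤ 2^{3m}`** for a 3CNF with `m` clauses. [folklore] -/
theorem numSat_le_two_pow (hφ : CNF.IsWidthEq 3 φ) : φ.numSat ≤ 2 ^ (φ.length * 3) :=
  (CNF.numSat_le φ).trans (Nat.pow_le_pow_right (by norm_num) (card_vars_le φ hφ))

/-- `0 ≤ per (twoSiteMatrix φ) ≤ 2^{9m}`. [cite: Valiant1979, Lemma 3.1] -/
theorem permanent_twoSiteMatrix_bounds (hφ : CNF.IsWidthEq 3 φ) :
    0 ≤ (twoSiteMatrix φ).permanent ∧ (twoSiteMatrix φ).permanent ≤ 2 ^ (φ.length * 9) := by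
  rw [permanent_twoSiteMatrix φ hφ]
  refine ⟨by positivity, ?_⟩
  have h := numSat_le_two_pow φ hφ
  calc (2 : ℤ) ^ (φ.length * 3 + φ.length * 3) * (φ.numSat : ℤ)
      ≤ 2 ^ (φ.length * 3 + φ.length * 3) * 2 ^ (φ.length * 3) := by
        gcongr
        exact_mod_cast h
    _ = 2 ^ (φ.length * 9) := by rw [← pow_add]; congr 1; ring

end Main

end ThreeCNFPer

end Literature.Computability.AlgebraicComplexity
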